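import Summits.ValiantsHypothesis.ValiantsHypothesis.Theorems.LacunarySymmetroidMatrixDescartesCensusCircuitRow
import Summits.ValiantsHypothesis.ValiantsHypothesis.Theorems.LacunarySymmetroidMatrixDescartesCensusFlankRow

/-!
# `MatrixDescartes` census — W4 boundary layer: the CIRCUIT TRIPLE ROW of a fewnomial at most one below Descartes-sharp

HONEST FRAMING.  Object-search cell `pub-symmetroid`, item `DoorA26 = PosRootLawAt 2 6 19` (stmt-ValiantsHypothesis-19979, OPEN,
typed, never asserted).  Companion of `…CensusCircuitRow` (the circuit number of one trinomial) and `…CensusFlankRow`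
(`countP_posRoots_le_countP_twists`, Euler twists with multiplicity).  The boundary face-row LPs of the cell (engine-2 g26/g27
FACELP, engine-1 g24's corrected second seat; table of record v2 = «THEOREM GB ∪ LP∩», R1842) rest on ONE row family besides the
letter identities: for a fewnomial `F = Σ_{t<n} c_t X^{e_t}` with the Descartes-sharp count (here: at least `n − 2` positive roots
with multiplicity suffice) and three positions `e_r < e_s < e_u`, killing the other `n − 3` exponents leaves a trinomial with a
positive root, whence — when its outer coefficients share a sign — the CIRCUIT inequality
`(p+q)^{p+q} |c_r M_r|^q |c_u M_u|^p ≤ |c_s M_s|^{p+q} q^q p^p` (`M_t` the integer twist multipliers, `p = e_s − e_r`,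
`q = e_u − e_s`).  This file proves exactly that, generically in `n, e, c, r, s, u` (`circuit_triple_row`): the kernel form of the
CORRECTED triple row (custody note TRIPLEROW-ERRATUM-E1G24: the row filed before 2026-08-27 used the `p = q` constant for all
triples).  A tool: it kills nothing by itself; typing an LP∩ kill would instantiate it once per weighted triple row and combine the
rows (in logarithms) with the alone / collision identities.  Nothing here bounds `ζ_sym(2,6)`, decides `DoorA26`, or bears on
`MatrixDescartes` (stmt-ValiantsHypothesis-18050) / `VP ≠ VNP`.
-/

-- `Summit.ValiantsHypothesis.ValiantsHypothesis.…` repeats a component by the D-0017 layout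
-- (single-conjunct summit), which the `dupNamespace` linter flags; the name is mandated.
set_option linter.dupNamespace false

namespace Summit.ValiantsHypothesis.ValiantsHypothesis.Theorems.LacunarySymmetroidMatrixDescartes.Census

open Polynomial Finset
open scoped BigOperators Polynomial

/-- **CIRCUIT TRIPLE ROW (kernel form of the corrected face-row LP row).**  Let `F = Σ_{t<n} c_t X^{e_t}` have at least
`n − 2` positive roots counted with multiplicity (e.g. a Descartes-sharp `n`-nomial), and let `r, s, u < n` be three indices with
`e_r < e_s < e_u`.  Killing the other `n − 3` exponents by Euler twists (`countP_posRoots_le_countP_twists`) multiplies `c_t` by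
`M_t = Π_{v ∉ {r,s,u}} (e_t − e_v)` and leaves a trinomial with a positive root; if its outer coefficients have the same sign
(`(c_r M_r)(c_u M_u) > 0` — automatic for a sharp form, here a hypothesis) the circuit row holds:
`(p+q)^{p+q} |c_r M_r|^q |c_u M_u|^p ≤ |c_s M_s|^{p+q} q^q p^p`, `p = e_s − e_r`, `q = e_u − e_s`
(`circuit_row_abs_of_posRoot`).  This is the row `(p+q)Y_s − qY_r − pY_u ≥ log K` of the CORRECTED boundary face-row LP
(TRIPLEROW-ERRATUM-E1G24) for ANY spacing. [cite: IlimanDewolff2016, Theorem 3.8 (n = 1)] -/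
theorem circuit_triple_row (n : ℕ) (e : ℕ → ℕ) (c : ℕ → ℝ) (r s u : ℕ) (hr : r < n) (hs : s < n) (hu : u < n)
    (hers : e r < e s) (hesu : e s < e u)
    (hZ : n - 2 ≤ (∑ t ∈ range n, C (c t) * X ^ (e t) : ℝ[X]).roots.countP (fun x => 0 < x))
    (hAD : 0 < (c r * ∏ v ∈ (range n) \ {r, s, u}, ((e r : ℝ) - e v)) * (c u * ∏ v ∈ (range n) \ {r, s, u}, ((e u : ℝ) - e v))) :
    (((e u - e r : ℕ) : ℝ)) ^ (e u - e r)
        * (|c r * ∏ v ∈ (range n) \ {r, s, u}, ((e r : ℝ) - e v)| ^ (e u - e s)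
          * |c u * ∏ v ∈ (range n) \ {r, s, u}, ((e u : ℝ) - e v)| ^ (e s - e r))
      ≤ |c s * ∏ v ∈ (range n) \ {r, s, u}, ((e s : ℝ) - e v)| ^ (e u - e r)
        * ((((e u - e s : ℕ) : ℝ)) ^ (e u - e s) * (((e s - e r : ℕ) : ℝ)) ^ (e s - e r)) := by
  classical
  have hrs : r ≠ s := fun h => by rw [h] at hers; exact lt_irrefl _ hers
  have hsu : s ≠ u := fun h => by rw [h] at hesu; exact lt_irrefl _ hesu
  have hru : r ≠ u := fun h => by rw [h] at hers; exact lt_irrefl _ (hers.trans hesu)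
  set U : Finset ℕ := (range n) \ {r, s, u} with hU
  set M : ℕ → ℝ := fun t => ∏ v ∈ U, ((e t : ℝ) - e v) with hM
  -- the kill set has `n − 3` elements
  have hsub : ({r, s, u} : Finset ℕ) ⊆ range n := by
    intro t ht
    simp only [mem_insert, mem_singleton] at ht
    rcases ht with rfl | rfl | rfl <;> simpa using ‹_›
  have hcard3 : ({r, s, u} : Finset ℕ).card = 3 := by
    rw [card_insert_of_notMem (by simp [hrs, hru]), card_insert_of_notMem (by simp [hsu]), card_singleton]
  have hUcard : U.card = n - 3 := by
    rw [hU, card_sdiff_of_subset hsub, card_range, hcard3]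
  -- twists
  have step := countP_posRoots_le_countP_twists n e c U
  rw [hUcard] at step
  -- the residual is the trinomial on `{r, s, u}`
  have hres : (∑ t ∈ range n, C (c t * ∏ v ∈ U, ((e t : ℝ) - e v)) * X ^ (e t) : ℝ[X])
      = C (c r * M r) * X ^ (e r) + C (c s * M s) * X ^ (e s) + C (c u * M u) * X ^ (e u) := by
    rw [← Finset.sum_subset hsub]
    · rw [sum_insert (by simp [hrs, hru]), sum_insert (by simp [hsu]), sum_singleton]
      ring
    · intro t ht hnot
      have htU : t ∈ U := by rw [hU, mem_sdiff]; exact ⟨ht, hnot⟩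
      rw [Finset.prod_eq_zero htU (sub_self _), mul_zero, map_zero, zero_mul]
  rw [hres] at step
  -- the trinomial has a positive root
  have hroot : 0 < ((C (c r * M r) * X ^ (e r) + C (c s * M s) * X ^ (e s) + C (c u * M u) * X ^ (e u) : ℝ[X]).roots.countP
      (fun x => 0 < x)) := by
    have h3 : 3 ≤ n := by omega
    omega
  -- exponents in circuit form
  have e1 : e s = e r + (e s - e r) := by omega
  have e2 : e u = e r + (e s - e r) + (e u - e s) := by omega
  have epq : e u - e r = (e s - e r) + (e u - e s) := by omega
  rw [e1, e2] at hroot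
  have key := circuit_row_abs_of_posRoot (c r * M r) (c s * M s) (c u * M u) (e r) (e s - e r) (e u - e s) hAD
    (by omega) (by omega) hroot
  rw [epq]
  push_cast
  convert key using 2
  push_cast
  ring

end Summit.ValiantsHypothesis.ValiantsHypothesis.Theorems.LacunarySymmetroidMatrixDescartes.Census
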